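import Literature.LinearAlgebra.RootSystem.AffineWeylGroupCoxeterSystem
import Literature.LinearAlgebra.RootSystem.AffineWeylGroupOmega
import HarnessLib

/-!
# `Ω` and the length: «`λ(ρσ) = λ(σ)`», «`λ(ρσρ⁻¹) = λ(σ)`» (Iwahori–Matsumoto 1965 §1.8, §1.10)

N. Iwahori, H. Matsumoto, *On some Bruhat decomposition and the structure of the Hecke rings of p-adic Chevalley groups*, Publ. Math. IHÉS
25 (1965) [IwahoriMatsumoto1965] (held `paper:doi-10-1007-bf02684396`). §1.7 (PDF pp. 12–13 = pp. 247–248): «Let us define a subgroup `Ω`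
of `DW` by `Ω = {σ ∈ DW ; σD∘ = D∘}`. Clearly `Ω` is defined also by `Ω = {σ ∈ DW ; λ(σ) = 0}`. … `DW = Ω·(D'W)`, `Ω ∩ D'W = {1}`. … It is
also easy to see that `λ(ρσρ') = λ(σ)` for any `σ ∈ DW` and `ρ, ρ' ∈ Ω`. In fact, `Λ(ρσρ') = Λ(ρσρ'D∘, D∘) = Λ(ρσD∘, D∘) = ρΛ(σD∘, D∘) = ρΛ(σ)`
implies that `λ(ρσρ') = λ(σ)`.» §1.8 (PDF p. 14 = p. 249): «We shall now consider the automorphism `σ ↦ ρσρ⁻¹` of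
`D'W` defined by `ρ ∈ Ω`. Since `λ(ρσρ⁻¹) = λ(σ)`, this automorphism induces a permutation of the set `{w₀, w₁, …, w_l}`.» §1.10 (PDF p. 20 =
p. 255): «Since `DW` is a semi-direct product of `Ω` and `D'W` and since `λ(ρσ) = λ(σ)` for `ρ ∈ Ω`, `σ ∈ D'W`, we have
`P(DW, t) = |Ω|·P(D'W, t)` where `|Ω|` is the order of `Ω`.» Here `λ(σ)` (`σ ∈ DW = Ŵ_a`) is the number of hyperplanes `P_{α,k}` separating `D∘`
from `σD∘` (§1.5), equal on `D'W = W_a` to the word length in `w₀, …, w_l` (Proposition 1.10).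
J. E. Humphreys, *Reflection Groups and Coxeter Groups* (1990) [Humphreys1990], §4.5 Theorem («`n(w) = ℓ(w)`») and §4.5 («`Ω` of those
`w ∈ Ŵ_a` such that `wA∘ = A∘`»).

THIS FILE (lane `lit-hodgefound`, prover seat p40, generation 45, row g45-#11; THEOREMS ONLY — no definition, instance, notation or named fact; net
debt 0), CONVENTIONS of the `AffineWeylGroup*` files (`Ω` in element language: `o ∈ Ŵ_a` with `oA∘ = A∘`; `σA∘ = alcove k`,
`2λ(σ) = Σ_α |k_α - k∘_α|`; `ℓ` = p13's word length in `wallReflection b η` on `W_a`):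

* §1 ★★ `sum_abs_data_eq_zero_iff` («`Ω` is defined also by `Ω = {σ ∈ DW ; λ(σ) = 0}`»: `Σ|k - k∘| = 0 ↔ σA∘ = A∘`); ★
  `image_mul_eq_of_image_fundamentalAlcove_eq` (`σρ'A∘ = σA∘`), ★★ `sum_abs_data_mul_eq_of_image_fundamentalAlcove_eq` («`λ(ρσ) = λ(σ)`» in
  floor data on `Ŵ_a`), ★★★ `sum_abs_data_mul_mul_eq_of_image_fundamentalAlcove_eq` («`λ(ρσρ') = λ(σ)` for any `σ ∈ DW` and `ρ, ρ' ∈ Ω`»),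
  ★★ `sum_abs_data_conj_eq` («`λ(ρσρ⁻¹) = λ(σ)`»).
* §2 ★★ `conj_mem_affineWeylGroup_of_mem_extendedAffineWeylGroup` (`ρσρ⁻¹ ∈ W_a` for `σ ∈ W_a`, `ρ ∈ Ŵ_a`, from g44-#1's normaliser),
  ★★★ `length_conj_eq_of_image_fundamentalAlcove_eq` («`λ(ρσρ⁻¹) = λ(σ)`» for the Coxeter length on `W_a`), ★★★
  `two_mul_length_eq_sum_abs_data_of_eq_mul` («`λ(ρσ) = λ(σ)`, `ρ ∈ Ω`, `σ ∈ D'W`»: for `u = ρσ ∈ Ŵ_a` with `uA∘ = alcove k`,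
  `Σ|k - k∘| = 2ℓ(σ)` — the length on `Ŵ_a = Ω ⋉ W_a` is read off the `W_a`-factor), ★★ `two_mul_length_eq_sum_abs_data_of_eq_mul'` (the same
  for `u = σρ`).

BY NAME, nothing restated: rows g44-#12 (`sum_abs_data_inv_eq`), g44-#6 (`alcove`, `fundamentalAlcove_eq_alcove`, `eq_of_mem_alcove_of_mem_alcove`),
g44-#2 (`smul_sum_filter_isPos_mem_fundamentalAlcove`), g44-#8 (`mul_mem_stabilizer`, `inv_mem_stabilizer`), g44-#1
(`extendedAffineWeylGroup_le_normalizer_affineWeylGroup`, `affineWeylGroup_le_extendedAffineWeylGroup`), g45-#1 (`wallReflection`,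
`two_mul_length_affineWeylGroup_eq`, `exists_two_mul_length_affineWeylGroup_eq`).

## References

* [IwahoriMatsumoto1965] N. Iwahori, H. Matsumoto, Publ. Math. IHÉS 25 (1965) 5–48, §1.7 (pp. 247–248), §1.8 (p. 249), §1.10 (p. 255).
* [Humphreys1990] J. E. Humphreys, *Reflection Groups and Coxeter Groups*, CUP (1990), §4.5.
* [Bourbaki2002LieGroups46] N. Bourbaki, *Lie Groups and Lie Algebras, Chapters 4–6*, Ch. VI §2 no. 3 (cite-only).
-/

noncomputable section

open Module Set Function
open Literature.GroupTheory.Coxeter Literature.GroupTheory.Coxeter.PreCoxeterSystem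

namespace Literature.LinearAlgebra.RootSystem

namespace Base

variable {ι K M N : Type*} [Field K] [LinearOrder K] [IsStrictOrderedRing K] [AddCommGroup M] [Module K M]
  [AddCommGroup N] [Module K N] [Fintype ι] [DecidableEq ι]
  {P : RootPairing ι K M N} [CharZero K] [P.IsCrystallographic] [P.IsReduced] (b : P.Base)

/-! ## §1 `λ` is `Ω`-bi-invariant (floor data on `Ŵ_a`) -/

section FloorData

/-- ★★ **«CLEARLY `Ω` IS DEFINED ALSO BY `Ω = {σ ∈ DW ; λ(σ) = 0}`»**: for `σA∘ = alcove k`, `Σ_α |k_α - k∘_α| = 0 ↔ σA∘ = A∘`.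
[cite: IwahoriMatsumoto1965, §1.7 ("Ω = {σ ∈ DW; σD∘ = D∘}. Clearly Ω is defined also by Ω = {σ ∈ DW; λ(σ) = 0}")] [cite: Humphreys1990, §4.5 ("Ω of those w ∈ Ŵ_a such that wA∘ = A∘")] -/
theorem sum_abs_data_eq_zero_iff [Nonempty ι] [DecidablePred b.IsPos] {η : ι}
    (hη : ∀ k, P.coroot η - P.coroot k ∈ AddSubmonoid.closure (P.coroot '' (b.support : Set ι))) {w : M ≃ᵃ[K] M} {k : ι → ℤ}
    (hk : w '' {x : M | ∀ i, b.IsPos i → 0 < P.coroot' i x ∧ P.coroot' i x < 1} = alcove P k) :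
    ∑ i, |k i - (if b.IsPos i then (0 : ℤ) else -1)| = 0 ↔
      w '' {x : M | ∀ i, b.IsPos i → 0 < P.coroot' i x ∧ P.coroot' i x < 1} =
        {x : M | ∀ i, b.IsPos i → 0 < P.coroot' i x ∧ P.coroot' i x < 1} := by
  obtain ⟨x₀, hx₀⟩ : {x : M | ∀ i, b.IsPos i → 0 < P.coroot' i x ∧ P.coroot' i x < 1}.Nonempty :=
    ⟨_, smul_sum_filter_isPos_mem_fundamentalAlcove b hη⟩
  have hy : w x₀ ∈ alcove P k := hk ▸ mem_image_of_mem _ hx₀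
  rw [Finset.sum_eq_zero_iff_of_nonneg (fun i _ ↦ abs_nonneg _), hk, fundamentalAlcove_eq_alcove b]
  constructor
  · intro h
    have hkk : k = fun i ↦ if b.IsPos i then (0 : ℤ) else -1 :=
      funext fun i ↦ sub_eq_zero.mp (abs_eq_zero.mp (h i (Finset.mem_univ i)))
    rw [hkk]
  · intro h i _
    rw [abs_eq_zero, sub_eq_zero]
    exact congrFun (eq_of_mem_alcove_of_mem_alcove hy (h ▸ hy)) i

omit [IsStrictOrderedRing K] [Fintype ι] [DecidableEq ι] [P.IsCrystallographic] [P.IsReduced] in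
/-- «`σρD∘ = σD∘`» for `ρD∘ = D∘`: right multiplication by `Ω` does not move the alcove `σA∘`. [cite: IwahoriMatsumoto1965, §1.7 ("Ω = {σ ∈ DW; σD∘ = D∘}")] -/
theorem image_mul_eq_of_image_fundamentalAlcove_eq {w o : M ≃ᵃ[K] M}
    (hoA : o '' {x : M | ∀ i, b.IsPos i → 0 < P.coroot' i x ∧ P.coroot' i x < 1} =
      {x : M | ∀ i, b.IsPos i → 0 < P.coroot' i x ∧ P.coroot' i x < 1}) :
    ⇑(w * o) '' {x : M | ∀ i, b.IsPos i → 0 < P.coroot' i x ∧ P.coroot' i x < 1} =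
      w '' {x : M | ∀ i, b.IsPos i → 0 < P.coroot' i x ∧ P.coroot' i x < 1} := by
  rw [AffineEquiv.coe_mul, image_comp, hoA]

/-- ★★ **«`λ(ρσ) = λ(σ)` FOR `ρ ∈ Ω`»** in floor data on `Ŵ_a`: if `ρA∘ = A∘`, `σA∘ = alcove k` and `ρσA∘ = alcove k'` (`ρ, σ ∈ Ŵ_a`), then
`Σ|k' - k∘| = Σ|k - k∘|` (both equal the count for `σ⁻¹A∘ = (ρσ)⁻¹A∘`, by «`n(w) = n(w⁻¹)`», row g44-#12).
[cite: IwahoriMatsumoto1965, §1.10 ("λ(ρσ) = λ(σ) for ρ ∈ Ω, σ ∈ D′W")] [cite: Humphreys1990, §4.4 ("n(w) = n(w⁻¹)")] -/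
theorem sum_abs_data_mul_eq_of_image_fundamentalAlcove_eq [Nonempty ι] [DecidablePred b.IsPos] {η : ι}
    (hη : ∀ k, P.coroot η - P.coroot k ∈ AddSubmonoid.closure (P.coroot '' (b.support : Set ι))) {o w : M ≃ᵃ[K] M}
    (ho : o ∈ extendedAffineWeylGroup P)
    (hoA : o '' {x : M | ∀ i, b.IsPos i → 0 < P.coroot' i x ∧ P.coroot' i x < 1} =
      {x : M | ∀ i, b.IsPos i → 0 < P.coroot' i x ∧ P.coroot' i x < 1})
    (hw : w ∈ extendedAffineWeylGroup P) {k k' : ι → ℤ}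
    (hk : w '' {x : M | ∀ i, b.IsPos i → 0 < P.coroot' i x ∧ P.coroot' i x < 1} = alcove P k)
    (hk' : ⇑(o * w) '' {x : M | ∀ i, b.IsPos i → 0 < P.coroot' i x ∧ P.coroot' i x < 1} = alcove P k') :
    ∑ i, |k' i - (if b.IsPos i then (0 : ℤ) else -1)| = ∑ i, |k i - (if b.IsPos i then (0 : ℤ) else -1)| := by
  obtain ⟨q, hq⟩ := exists_image_eq_alcove_of_mem_extendedAffineWeylGroup (inv_mem hw) (fun i ↦ if b.IsPos i then (0 : ℤ) else -1)
  rw [← fundamentalAlcove_eq_alcove b] at hq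
  have hq' : ⇑(o * w)⁻¹ '' {x : M | ∀ i, b.IsPos i → 0 < P.coroot' i x ∧ P.coroot' i x < 1} = alcove P q := by
    rw [mul_inv_rev, AffineEquiv.coe_mul, image_comp, (inv_mem_stabilizer b ho hoA).2, hq]
  rw [sum_abs_data_inv_eq b hη (mul_mem ho hw) hk' hq', sum_abs_data_inv_eq b hη hw hk hq]

/-- ★★★ **«`λ(ρσρ') = λ(σ)` FOR ANY `σ ∈ DW` AND `ρ, ρ' ∈ Ω`»** in floor data on `Ŵ_a`: if `ρA∘ = A∘ = ρ'A∘`, `σA∘ = alcove k` and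
`ρσρ'A∘ = alcove k'`, then `Σ|k' - k∘| = Σ|k - k∘|` («`Λ(ρσρ') = Λ(ρσρ'D∘, D∘) = Λ(ρσD∘, D∘) = ρΛ(σD∘, D∘)`»).
[cite: IwahoriMatsumoto1965, §1.7 ("It is also easy to see that λ(ρσρ′) = λ(σ) for any σ ∈ DW and ρ, ρ′ ∈ Ω")] -/
theorem sum_abs_data_mul_mul_eq_of_image_fundamentalAlcove_eq [Nonempty ι] [DecidablePred b.IsPos] {η : ι}
    (hη : ∀ k, P.coroot η - P.coroot k ∈ AddSubmonoid.closure (P.coroot '' (b.support : Set ι))) {o o' w : M ≃ᵃ[K] M}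
    (ho : o ∈ extendedAffineWeylGroup P)
    (hoA : o '' {x : M | ∀ i, b.IsPos i → 0 < P.coroot' i x ∧ P.coroot' i x < 1} =
      {x : M | ∀ i, b.IsPos i → 0 < P.coroot' i x ∧ P.coroot' i x < 1})
    (ho' : o' ∈ extendedAffineWeylGroup P)
    (ho'A : o' '' {x : M | ∀ i, b.IsPos i → 0 < P.coroot' i x ∧ P.coroot' i x < 1} =
      {x : M | ∀ i, b.IsPos i → 0 < P.coroot' i x ∧ P.coroot' i x < 1})
    (hw : w ∈ extendedAffineWeylGroup P) {k k' : ι → ℤ}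
    (hk : w '' {x : M | ∀ i, b.IsPos i → 0 < P.coroot' i x ∧ P.coroot' i x < 1} = alcove P k)
    (hk' : ⇑(o * w * o') '' {x : M | ∀ i, b.IsPos i → 0 < P.coroot' i x ∧ P.coroot' i x < 1} = alcove P k') :
    ∑ i, |k' i - (if b.IsPos i then (0 : ℤ) else -1)| = ∑ i, |k i - (if b.IsPos i then (0 : ℤ) else -1)| := by
  have h1 : ⇑(w * o') '' {x : M | ∀ i, b.IsPos i → 0 < P.coroot' i x ∧ P.coroot' i x < 1} = alcove P k := by
    rw [image_mul_eq_of_image_fundamentalAlcove_eq b ho'A, hk]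
  have h2 : ⇑(o * (w * o')) '' {x : M | ∀ i, b.IsPos i → 0 < P.coroot' i x ∧ P.coroot' i x < 1} = alcove P k' := by
    rwa [← mul_assoc]
  exact sum_abs_data_mul_eq_of_image_fundamentalAlcove_eq b hη ho hoA (mul_mem hw ho') h1 h2

/-- ★★ **«`λ(ρσρ⁻¹) = λ(σ)`»** in floor data on `Ŵ_a`: if `ρA∘ = A∘`, `σA∘ = alcove k` and `ρσρ⁻¹A∘ = alcove k'`, then `Σ|k' - k∘| = Σ|k - k∘|`.
[cite: IwahoriMatsumoto1965, §1.8 ("Since λ(ρσρ⁻¹) = λ(σ), this automorphism induces a permutation of the set {w₀, w₁, …, w_l}")] -/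
theorem sum_abs_data_conj_eq [Nonempty ι] [DecidablePred b.IsPos] {η : ι}
    (hη : ∀ k, P.coroot η - P.coroot k ∈ AddSubmonoid.closure (P.coroot '' (b.support : Set ι))) {o w : M ≃ᵃ[K] M}
    (ho : o ∈ extendedAffineWeylGroup P)
    (hoA : o '' {x : M | ∀ i, b.IsPos i → 0 < P.coroot' i x ∧ P.coroot' i x < 1} =
      {x : M | ∀ i, b.IsPos i → 0 < P.coroot' i x ∧ P.coroot' i x < 1})
    (hw : w ∈ extendedAffineWeylGroup P) {k k' : ι → ℤ}
    (hk : w '' {x : M | ∀ i, b.IsPos i → 0 < P.coroot' i x ∧ P.coroot' i x < 1} = alcove P k)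
    (hk' : ⇑(o * w * o⁻¹) '' {x : M | ∀ i, b.IsPos i → 0 < P.coroot' i x ∧ P.coroot' i x < 1} = alcove P k') :
    ∑ i, |k' i - (if b.IsPos i then (0 : ℤ) else -1)| = ∑ i, |k i - (if b.IsPos i then (0 : ℤ) else -1)| := by
  exact sum_abs_data_mul_mul_eq_of_image_fundamentalAlcove_eq b hη ho hoA (inv_mem_stabilizer b ho hoA).1 (inv_mem_stabilizer b ho hoA).2
    hw hk hk'

end FloorData

/-! ## §2 The Coxeter length on `W_a` -/

section Length

omit [LinearOrder K] [IsStrictOrderedRing K] [Fintype ι] [DecidableEq ι] [CharZero K] [P.IsCrystallographic] [P.IsReduced] in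
/-- `ρσρ⁻¹ ∈ W_a` for `σ ∈ W_a`, `ρ ∈ Ŵ_a` (row g44-#1: `Ŵ_a` normalises `W_a`). [cite: Humphreys1990, §4.2 ("contains W_a as a normal subgroup")] [cite: IwahoriMatsumoto1965, §1.2 ("D′W is a distinguished subgroup of DW")] -/
theorem conj_mem_affineWeylGroup_of_mem_extendedAffineWeylGroup {o w : M ≃ᵃ[K] M} (ho : o ∈ extendedAffineWeylGroup P)
    (hw : w ∈ affineWeylGroup P) : o * w * o⁻¹ ∈ affineWeylGroup P :=
  ((Subgroup.mem_normalizer_iff.mp (extendedAffineWeylGroup_le_normalizer_affineWeylGroup P ho)) w).mp hw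

/-- ★★★ **«`λ(ρσρ⁻¹) = λ(σ)`» FOR THE COXETER LENGTH ON `W_a`**: conjugation by `ρ ∈ Ω` preserves p13's word length in the `wallReflection`s
(row g45-#1: `2ℓ = Σ|k - k∘|`; §1). [cite: IwahoriMatsumoto1965, §1.8 ("Since λ(ρσρ⁻¹) = λ(σ)") and §1.5 Proposition 1.10] [cite: Humphreys1990, §4.5 Theorem] -/
theorem length_conj_eq_of_image_fundamentalAlcove_eq [Nonempty ι] {η : ι}
    (hη : ∀ k, P.coroot η - P.coroot k ∈ AddSubmonoid.closure (P.coroot '' (b.support : Set ι))) {o : M ≃ᵃ[K] M}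
    (ho : o ∈ extendedAffineWeylGroup P)
    (hoA : o '' {x : M | ∀ i, b.IsPos i → 0 < P.coroot' i x ∧ P.coroot' i x < 1} =
      {x : M | ∀ i, b.IsPos i → 0 < P.coroot' i x ∧ P.coroot' i x < 1}) (w : affineWeylGroup P) :
    PreCoxeterSystem.length (wallReflection b η)
        ⟨o * w * o⁻¹, conj_mem_affineWeylGroup_of_mem_extendedAffineWeylGroup ho w.2⟩ =
      PreCoxeterSystem.length (wallReflection b η) w := by
  classical
  obtain ⟨k, hk, h1⟩ := exists_two_mul_length_affineWeylGroup_eq b hη w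
  obtain ⟨k', hk', h2⟩ := exists_two_mul_length_affineWeylGroup_eq b hη
    ⟨o * w * o⁻¹, conj_mem_affineWeylGroup_of_mem_extendedAffineWeylGroup ho w.2⟩
  have h3 := sum_abs_data_conj_eq b hη ho hoA (affineWeylGroup_le_extendedAffineWeylGroup P w.2) hk hk'
  omega

/-- ★★★ **«`λ(ρσ) = λ(σ)` FOR `ρ ∈ Ω`, `σ ∈ D′W`» — THE COUNT ON `Ŵ_a = Ω ⋉ W_a` IS THE LENGTH OF THE `W_a`-FACTOR**: for `ρ ∈ Ŵ_a` with `ρA∘ = A∘`,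
`σ ∈ W_a` and `ρσA∘ = alcove k`, `Σ_α |k_α - k∘_α| = 2ℓ(σ)`. [cite: IwahoriMatsumoto1965, §1.10 ("since λ(ρσ) = λ(σ) for ρ ∈ Ω, σ ∈ D′W, we have P(DW, t) = |Ω|·P(D′W, t)")] [cite: Humphreys1990, §4.5 Theorem] -/
theorem two_mul_length_eq_sum_abs_data_of_eq_mul [Nonempty ι] [DecidablePred b.IsPos] {η : ι}
    (hη : ∀ k, P.coroot η - P.coroot k ∈ AddSubmonoid.closure (P.coroot '' (b.support : Set ι))) {o : M ≃ᵃ[K] M}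
    (ho : o ∈ extendedAffineWeylGroup P)
    (hoA : o '' {x : M | ∀ i, b.IsPos i → 0 < P.coroot' i x ∧ P.coroot' i x < 1} =
      {x : M | ∀ i, b.IsPos i → 0 < P.coroot' i x ∧ P.coroot' i x < 1}) (w : affineWeylGroup P) {k : ι → ℤ}
    (hk : ⇑(o * w) '' {x : M | ∀ i, b.IsPos i → 0 < P.coroot' i x ∧ P.coroot' i x < 1} = alcove P k) :
    2 * (PreCoxeterSystem.length (wallReflection b η) w : ℤ) = ∑ i, |k i - (if b.IsPos i then (0 : ℤ) else -1)| := by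
  obtain ⟨k₁, hk₁, h1⟩ := exists_two_mul_length_affineWeylGroup_eq b hη w
  rw [h1, sum_abs_data_mul_eq_of_image_fundamentalAlcove_eq b hη ho hoA (affineWeylGroup_le_extendedAffineWeylGroup P w.2) hk₁ hk]

/-- ★★ The same for `σρ`: `σρA∘ = σA∘`, so `Σ_α |k_α - k∘_α| = 2ℓ(σ)` for `σρA∘ = alcove k`.
[cite: IwahoriMatsumoto1965, §1.10 ("λ(ρσ) = λ(σ) for ρ ∈ Ω, σ ∈ D′W") and §1.7 ("DW = Ω·(D′W)")] -/
theorem two_mul_length_eq_sum_abs_data_of_eq_mul' [Nonempty ι] [DecidablePred b.IsPos] {η : ι}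
    (hη : ∀ k, P.coroot η - P.coroot k ∈ AddSubmonoid.closure (P.coroot '' (b.support : Set ι))) {o : M ≃ᵃ[K] M}
    (hoA : o '' {x : M | ∀ i, b.IsPos i → 0 < P.coroot' i x ∧ P.coroot' i x < 1} =
      {x : M | ∀ i, b.IsPos i → 0 < P.coroot' i x ∧ P.coroot' i x < 1}) (w : affineWeylGroup P) {k : ι → ℤ}
    (hk : ⇑((w : M ≃ᵃ[K] M) * o) '' {x : M | ∀ i, b.IsPos i → 0 < P.coroot' i x ∧ P.coroot' i x < 1} = alcove P k) :
    2 * (PreCoxeterSystem.length (wallReflection b η) w : ℤ) = ∑ i, |k i - (if b.IsPos i then (0 : ℤ) else -1)| := by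
  rw [image_mul_eq_of_image_fundamentalAlcove_eq b hoA] at hk
  exact two_mul_length_affineWeylGroup_eq b hη w hk

end Length

end Base

end Literature.LinearAlgebra.RootSystem
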